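import Literature.NumberTheory.Rogawski1990.ArchExplicitTransferFactorCayleyTorus     -- ★ LH3-p04 (g2) p849548: the compact-chart edition (brings (μ-guard-∞) `exists_odd_archHeckeValue_single_eq_zpow`, `archHeckeValue_eq_prod_single`)
import Literature.NumberTheory.Automorphic.ArchInnerFormCartanAtlas                     -- ★ (T-ATLAS) PART 2b LH3-p03 (g2): `boostEig` (the eigenvalue triple `(e^{x+iθ}, e^{iφ}, e^{−x+iθ})`)
import Literature.NumberTheory.Automorphic.ArchEndoscopicCartanAtlas                     -- ★ (T-ATLAS) PART 1 p849525: `endoTorus S c`, `endoBlock`, `endoCircle`, `coe_endoBlock_of_mem∕_of_not_mem`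
import HarnessLib

/-!
# (I₁-Δ-S), `H`-side: `τ·D_{G∕H,∞}` along the general chart `endoTorus S c` is the SAME Laurent polynomial in the eigenvalue triple as on the compact chart
# (Rogawski 1990 §4.9 p. 55, §8.2 p. 119; Shelstad 1979 §4; Knapp 1986 Ch. V §3)

Topic `NumberTheory/Rogawski1990`; namespace `Literature.NumberTheory.Rogawski1990`.  THEOREMS ONLY (no `def`, no instance, no notation, no axiom, no named fact, no `sorry`).
Cell `pub/hodgecm-mathlib`, line LH3 (closer stub `stub_N9`, crux H413 = `stmt-HodgeConjecture-24833`), DIRECT ROAD organ **(I₁-Δ-S)** (LH3-plan (g2) 05:33Z: «ED. 2 of p849548 on the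
general chart `endoTorus S c` (★ atlas p849525; hyperbolic `z₀ = e^{x+iθ}`, `z₂ = e^{−x+iθ}`, same algebra, `μ_∞(A) = (A∕|A|)^m` for any `A ≠ 0`)»), PART 1 = the `H`-side factor
`τ(γ_H)·D_{G∕H,∞}(γ_H)` at `γ_H = endoTorus S c` (split Cartan at `w ∈ S`, compact Cayley block at `w ∉ S`).  PART 2 (next file) = the partners `gprimeTorus α S c∘ρ`, their `κ_w`
(the boost's `u`-eigenline is the second even line) and `Δ″` itself.

THE EIGENVALUE TRIPLE `E_w = (A_w, C_w, B_w)` of the place component: `E_w = boostEig (c w) = (e^{x+iθ}, e^{iφ}, e^{−x+iθ})` (`x = c w 0`, `φ = c w 1`, `θ = c w 2`) at `w ∈ S`,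
`E_w = (e^{i c w 0}, e^{i c w 1}, e^{i c w 2})` at `w ∉ S`; in both charts the 2-block has eigenvalues `E_w 0, E_w 2` and the 1-block entry is `E_w 1 = e^{i c w 1}` — the slot
convention of ★ p849548 (`z_{w,0}, z_{w,2}` ∕ `z_{w,1}`).  Written inline as `if w ∈ S then boostEig (c w) else (i ↦ ↑(Circle.exp (c w i)))`.

THE POINT (census LH3-p04 (g2) 06:3xZ).  With `a = E_w 0`, `b = E_w 2`, `u = E_w 1`: on the compact chart `ā = a⁻¹, b̄ = b⁻¹`; on the split chart `ā = b⁻¹, b̄ = a⁻¹`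
(`e^{x+iθ}‾ = e^{x−iθ} = (e^{−x+iθ})⁻¹`).  Rogawski's p. 119 computation only uses the SYMMETRIC functions `ā + b̄ = a⁻¹ + b⁻¹`, `ā b̄ = a⁻¹ b⁻¹` (and `|u| = 1`): with `q = (u−a)(u−b)`,
`A = −q∕(ab)`, `μ_w(z) = (z∕|z|)^{2k+1}` (★ (μ-guard-∞)), `μ_w(u)·μ_w(A)⁻¹·|q| = −(ab)^k q∕u` IN BOTH CHARTS (`unitary_key`).  Hence
`τ·D_{G∕H,∞}(endoTorus S c) = Π_w −((E_w0 E_w2)^{k_w}(E_w1 − E_w0)(E_w1 − E_w2))∕E_w1` — literally the compact formula ★ `exists_archTau_mul_archWeylRatio_cayleyTorus_eq` with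
`z_{w,i} ↦ E_w i`, now an entire function of `(x_w, θ_w, φ_w)` at the split places (no modulus, no sign: the (I₁-Δ) smoothness across `x = 0` and the (Δ-lim) value at the Cayley
point `x = 0` are READ OFF).

WHAT IS PROVED.  §0 `unitary_key` (private algebra).  §1 readings at `endoTorus S c`: `map_evalC_fst∕snd_endoTorus`, `evalC_archGammaTwo_endoTorus` (`= e^{i c w 1}`),
`evalC_eval_archCharpolyTwo_endoTorus` (`= (E1 − E0)(E1 − E2)`), `evalC_det_fst_endoTorus` (`= E0·E2`), `evalC_archTauArg_endoTorus`, **`archWeylRatio_endoTorus`**.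
§2 **`exists_archTau_mul_archWeylRatio_endoTorus_eq`** (the Laurent form, all `S`, all `c`, under `hμω`).
HONEST LABEL: HC_CM is proved only modulo the 7 printed citations (2 remaining: hLiu418 = stmt-HodgeConjecture-24832, h413 = stmt-HodgeConjecture-24833) until rung 0 closes; kit for
(I₁-Δ)∕(Δ-lim)∕(M3) of `stub_N9`'s L2, pays nothing by itself.

## References
* [Rogawski1990] J. D. Rogawski, *Automorphic Representations of Unitary Groups in Three Variables*, Ann. of Math. Stud. 123 (1990), §4.9 p. 55, §8.2 pp. 119, 122–123, §3.6 p. 31.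
* [Shelstad1979] D. Shelstad, *Characters and inner forms of a quasi-split group over ℝ*, Compositio Math. 39 (1979), §4 pp. 22–25.
* [Knapp1986] A. W. Knapp, *Representation Theory of Semisimple Groups* (1986), Ch. V §3.
-/

set_option autoImplicit false

noncomputable section

open NumberField NumberField.InfinitePlace Polynomial Complex Equiv
open scoped MatrixGroups ComplexConjugate Classical
open Literature.NumberTheory.Automorphic Literature.NumberTheory.Automorphic.UnitaryGroup Literature.NumberTheory.GaloisRepresentations

namespace Literature.NumberTheory.Rogawski1990

/-! ## §0 Scalar algebra (private) -/

/-- Pure `zpow` bookkeeping (verbatim ★ p849548): for non-zero `u v q n` with `n² = q²(u²v)⁻¹`, `u^{2k+1}·((−(q v⁻¹)∕n)^{2k+1})⁻¹·n = −v^k q∕u`. [folklore] -/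
private theorem zpow_bookkeeping' (u v q n : ℂ) (hu : u ≠ 0) (hv : v ≠ 0) (hq : q ≠ 0) (hn : n ≠ 0)
    (R : n ^ (2 : ℤ) = q ^ (2 : ℤ) * (u ^ (2 : ℤ) * v)⁻¹) (k : ℤ) :
    u ^ (2 * k + 1) * (((-(q * v⁻¹) / n) ^ (2 * k + 1))⁻¹ * n) = -(v ^ k * q / u) := by
  have hm : Odd (2 * k + 1) := ⟨k, rfl⟩
  have e1 : ((-(q * v⁻¹) / n) ^ (2 * k + 1))⁻¹ * n = -(q ^ (-(2 * k + 1)) * v ^ (2 * k + 1) * (n ^ (2 * k + 1) * n)) := by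
    have h : (-(q * v⁻¹) / n) = (-1) * q * v⁻¹ * n⁻¹ := by rw [div_eq_mul_inv]; ring
    rw [h, ← inv_zpow, mul_inv, mul_inv, mul_inv, inv_inv, inv_inv, inv_neg_one, mul_zpow, mul_zpow, mul_zpow, hm.neg_one_zpow,
      inv_zpow' q]
    ring
  have e2 : n ^ (2 * k + 1) * n = q ^ (2 * (k + 1)) * u ^ (-(2 * (k + 1))) * v ^ (-(k + 1)) := by
    rw [← zpow_add_one₀ hn, show (2 * k + 1 + 1 : ℤ) = 2 * (k + 1) by ring, zpow_mul, R, mul_zpow, inv_zpow, mul_zpow, ← zpow_mul, ← zpow_mul, mul_inv,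
      ← zpow_neg, ← zpow_neg]
    ring
  rw [e1, e2]
  have cu : u ^ (2 * k + 1) * u ^ (-(2 * (k + 1))) = u⁻¹ := by rw [← zpow_add₀ hu, show (2 * k + 1 + -(2 * (k + 1)) : ℤ) = -1 by ring, zpow_neg_one]
  have cq : q ^ (-(2 * k + 1)) * q ^ (2 * (k + 1)) = q := by rw [← zpow_add₀ hq, show (-(2 * k + 1) + 2 * (k + 1) : ℤ) = 1 by ring, zpow_one]
  have cv : v ^ (2 * k + 1) * v ^ (-(k + 1)) = v ^ k := by rw [← zpow_add₀ hv]; congr 1; ring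
  calc u ^ (2 * k + 1) * -(q ^ (-(2 * k + 1)) * v ^ (2 * k + 1) * (q ^ (2 * (k + 1)) * u ^ (-(2 * (k + 1))) * v ^ (-(k + 1))))
      = -((u ^ (2 * k + 1) * u ^ (-(2 * (k + 1)))) * (q ^ (-(2 * k + 1)) * q ^ (2 * (k + 1))) * (v ^ (2 * k + 1) * v ^ (-(k + 1)))) := by ring
    _ = -(u⁻¹ * q * v ^ k) := by rw [cu, cq, cv]
    _ = -(v ^ k * q / u) := by rw [div_eq_mul_inv]; ring

/-- **Rogawski's p. 119 computation in BOTH charts**: for `u` on the unit circle and non-zero `a, b` whose conjugates are `{a⁻¹, b⁻¹}` AS A SET (`ā + b̄ = a⁻¹ + b⁻¹`,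
`ā b̄ = a⁻¹ b⁻¹`: compact chart `ā = a⁻¹, b̄ = b⁻¹`; split chart `ā = b⁻¹, b̄ = a⁻¹`) and `m = 2k+1`, with `q = (u − a)(u − b)`, `A = −q∕(ab)`:
`(u∕‖u‖)^m · ((A∕‖A‖)^m)⁻¹ · ‖q‖ = −(ab)^k·q∕u`. [cite: Rogawski1990, §8.2 p. 119] [cite: Knapp1986, Ch. V §3] -/
private theorem unitary_key (a u b : ℂ) (ha0 : a ≠ 0) (hb0 : b ≠ 0) (hu : ‖u‖ = 1)
    (hsum : conj a + conj b = a⁻¹ + b⁻¹) (hprod : conj a * conj b = a⁻¹ * b⁻¹) (k : ℤ) :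
    (u / (‖u‖ : ℂ)) ^ (2 * k + 1) *
      (((-(((u - a) * (u - b)) * (a * b)⁻¹)) / (‖-(((u - a) * (u - b)) * (a * b)⁻¹)‖ : ℂ)) ^ (2 * k + 1))⁻¹ * (‖(u - a) * (u - b)‖ : ℂ) =
      -((a * b) ^ k * ((u - a) * (u - b)) / u) := by
  rw [mul_assoc]
  have hu0 : u ≠ 0 := fun h => by simp [h] at hu
  set q : ℂ := (u - a) * (u - b) with hq
  rw [hu, Complex.ofReal_one, div_one]
  by_cases hq0 : q = 0
  · simp [hq0]
  have hab : a * b ≠ 0 := mul_ne_zero ha0 hb0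
  have hnab : ‖a * b‖ = 1 := by
    have h1 : a * b * conj (a * b) = 1 := by rw [map_mul, hprod]; field_simp
    have h2 : (‖a * b‖ : ℝ) ^ 2 = 1 := by
      have h3 := Complex.mul_conj (a * b)
      rw [h1] at h3
      rw [Complex.sq_norm]
      exact_mod_cast h3.symm
    nlinarith [norm_nonneg (a * b)]
  have hnA : (‖-(q * (a * b)⁻¹)‖ : ℂ) = (‖q‖ : ℂ) := by
    rw [norm_neg, norm_mul, norm_inv, hnab, inv_one, mul_one]
  have hcu : conj u = u⁻¹ := (Complex.inv_eq_conj hu).symm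
  have hnq0 : (‖q‖ : ℂ) ≠ 0 := Complex.ofReal_ne_zero.2 (norm_ne_zero_iff.2 hq0)
  have hcq : conj q = (u⁻¹ - a⁻¹) * (u⁻¹ - b⁻¹) := by
    rw [hq, map_mul, map_sub, map_sub, hcu]
    linear_combination (-u⁻¹) * hsum + hprod
  have R : ((‖q‖ : ℂ)) ^ (2 : ℤ) = q ^ (2 : ℤ) * (u ^ (2 : ℤ) * (a * b))⁻¹ := by
    have h1 : ((‖q‖ : ℂ)) ^ (2 : ℤ) = q * conj q := by rw [zpow_two, Complex.mul_conj, Complex.normSq_eq_norm_sq]; push_cast; ring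
    rw [h1, hcq, hq, zpow_two, zpow_two]
    field_simp
    ring
  rw [hnA]
  exact zpow_bookkeeping' u (a * b) q (‖q‖ : ℂ) hu0 hab hq0 hnq0 R k

section EndoTorus

variable (L : Type) [Field L] [NumberField L] [IsCMField L] (μ : HeckeCharacter L)
  (S : Finset {w : InfinitePlace L // IsComplex w}) (c : {w : InfinitePlace L // IsComplex w} → Fin 3 → ℝ) (w : {w : InfinitePlace L // IsComplex w})

/-! ## §1 Per-place readings at `endoTorus S c` -/

/-- The `w`-component of the 2-block of `endoTorus S c` is the atlas block `endoBlock S c w`. [cite: Rogawski1990, §3.6 p. 31; §8.2 p. 122] -/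
theorem map_evalC_fst_endoTorus :
    Matrix.GeneralLinearGroup.map (UnitaryGroup.evalC L w) (((endoTorus L S c).1 : ↥(UnitaryGroup.arch (↥(maximalRealSubfield L)) L (IsCMField.complexConj L) 2
        (Matrix.of fun i j : Fin 2 => if i.val + j.val + 1 = 2 then (1 : L) else 0))) : GL (Fin 2) (mixedEmbedding.mixedSpace L)) =
      ((endoBlock L S c w : ↥(archLocal L 2 (Matrix.of fun i j : Fin 2 => if i.val + j.val + 1 = 2 then (1 : L) else 0) w)) : GL (Fin 2) ℂ) := by
  change (((UnitaryGroup.archPiEquivCM 2 L (Matrix.of fun i j : Fin 2 => if i.val + j.val + 1 = 2 then (1 : L) else 0)) (endoTorus L S c).1 w :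
      ↥(UnitaryGroup.archLocal L 2 (Matrix.of fun i j : Fin 2 => if i.val + j.val + 1 = 2 then (1 : L) else 0) w)) : GL (Fin 2) ℂ) = _
  rw [archPiEquivCM_endoTorus_fst]

/-- The `w`-component of the 1-block of `endoTorus S c` is `endoCircle c w = diag(e^{i c w 1})`. [cite: Rogawski1990, §4.9 p. 54] -/
theorem map_evalC_snd_endoTorus :
    Matrix.GeneralLinearGroup.map (UnitaryGroup.evalC L w) (((endoTorus L S c).2 : ↥(UnitaryGroup.arch (↥(maximalRealSubfield L)) L (IsCMField.complexConj L) 1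
        (Matrix.of fun i j : Fin 1 => if i.val + j.val + 1 = 1 then (1 : L) else 0))) : GL (Fin 1) (mixedEmbedding.mixedSpace L)) =
      ((endoCircle L c w : ↥(archLocal L 1 (Matrix.of fun i j : Fin 1 => if i.val + j.val + 1 = 1 then (1 : L) else 0) w)) : GL (Fin 1) ℂ) := by
  change (((UnitaryGroup.archPiEquivCM 1 L (Matrix.of fun i j : Fin 1 => if i.val + j.val + 1 = 1 then (1 : L) else 0)) (endoTorus L S c).2 w :
      ↥(UnitaryGroup.archLocal L 1 (Matrix.of fun i j : Fin 1 => if i.val + j.val + 1 = 1 then (1 : L) else 0) w)) : GL (Fin 1) ℂ) = _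
  rw [archPiEquivCM_endoTorus_snd]

omit [NumberField L] [IsCMField L] in
/-- The 1-block eigenvalue is the middle entry of the triple in both charts: `E_w 1 = e^{i c w 1}`. [cite: Rogawski1990, §4.9 p. 54] -/
private theorem triple_one :
    (if w ∈ S then boostEig (c w) else fun i => (Circle.exp (c w i) : ℂ)) 1 = (Circle.exp (c w 1) : ℂ) := by
  split_ifs with hw
  · simp [boostEig, Circle.coe_exp]
  · rfl

/-- The `w`-matrix of the 2-block: `diag(E0, E2)` at `w ∈ S`, `½·[[E0+E2, E0−E2],[E0−E2, E0+E2]]` at `w ∉ S`; in both cases `tr = E0 + E2`, `det = E0·E2`.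
[cite: Rogawski1990, §3.6 p. 31; §8.2 p. 122] -/
private theorem trace_det_map_evalC_fst_endoTorus :
    (((((endoTorus L S c).1 : ↥(UnitaryGroup.arch (↥(maximalRealSubfield L)) L (IsCMField.complexConj L) 2
        (Matrix.of fun i j : Fin 2 => if i.val + j.val + 1 = 2 then (1 : L) else 0))) : GL (Fin 2) (mixedEmbedding.mixedSpace L)) :
          Matrix (Fin 2) (Fin 2) (mixedEmbedding.mixedSpace L)).map (UnitaryGroup.evalC L w)).trace =
        (if w ∈ S then boostEig (c w) else fun i => (Circle.exp (c w i) : ℂ)) 0 + (if w ∈ S then boostEig (c w) else fun i => (Circle.exp (c w i) : ℂ)) 2 ∧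
    (((((endoTorus L S c).1 : ↥(UnitaryGroup.arch (↥(maximalRealSubfield L)) L (IsCMField.complexConj L) 2
        (Matrix.of fun i j : Fin 2 => if i.val + j.val + 1 = 2 then (1 : L) else 0))) : GL (Fin 2) (mixedEmbedding.mixedSpace L)) :
          Matrix (Fin 2) (Fin 2) (mixedEmbedding.mixedSpace L)).map (UnitaryGroup.evalC L w)).det =
        (if w ∈ S then boostEig (c w) else fun i => (Circle.exp (c w i) : ℂ)) 0 * (if w ∈ S then boostEig (c w) else fun i => (Circle.exp (c w i) : ℂ)) 2 := by
  have h := congrArg (fun g : GL (Fin 2) ℂ => (g : Matrix (Fin 2) (Fin 2) ℂ)) (map_evalC_fst_endoTorus L S c w)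
  have h' : ((((endoTorus L S c).1 : ↥(UnitaryGroup.arch (↥(maximalRealSubfield L)) L (IsCMField.complexConj L) 2
        (Matrix.of fun i j : Fin 2 => if i.val + j.val + 1 = 2 then (1 : L) else 0))) : GL (Fin 2) (mixedEmbedding.mixedSpace L)) :
          Matrix (Fin 2) (Fin 2) (mixedEmbedding.mixedSpace L)).map (UnitaryGroup.evalC L w) =
      ((endoBlock L S c w : ↥(archLocal L 2 (Matrix.of fun i j : Fin 2 => if i.val + j.val + 1 = 2 then (1 : L) else 0) w)) : GL (Fin 2) ℂ) :=
    (Eq.trans rfl h : _)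
  rw [h']
  by_cases hw : w ∈ S
  · rw [coe_endoBlock_of_mem L c hw, if_pos hw, Matrix.trace_fin_two_of, Matrix.det_fin_two_of]
    simp [boostEig]
  · rw [coe_endoBlock_of_not_mem L c hw, if_neg hw, Matrix.trace_fin_two_of, Matrix.det_fin_two_of]
    constructor <;> ring

/-- **`σ_w(γ₂) = e^{i c w 1}` at `endoTorus S c`** (both charts). [cite: Rogawski1990, §4.9 p. 55] -/
theorem evalC_archGammaTwo_endoTorus : UnitaryGroup.evalC L w (archGammaTwo L (endoTorus L S c)) = (Circle.exp (c w 1) : ℂ) := by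
  have h := congrArg (fun g : GL (Fin 1) ℂ => (g : Matrix (Fin 1) (Fin 1) ℂ) 0 0) (map_evalC_snd_endoTorus L S c w)
  simp only [coe_endoCircle, Matrix.diagonal_apply_eq] at h
  exact h

/-- **`σ_w(χ_g(γ₂)) = (E_w1 − E_w0)(E_w1 − E_w2)`** at `endoTorus S c`. [cite: Rogawski1990, §4.9 p. 55; §8.2 p. 123] -/
theorem evalC_eval_archCharpolyTwo_endoTorus :
    UnitaryGroup.evalC L w ((archCharpolyTwo L (endoTorus L S c)).eval (archGammaTwo L (endoTorus L S c))) =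
      (((if w ∈ S then boostEig (c w) else fun i => (Circle.exp (c w i) : ℂ)) 1) - ((if w ∈ S then boostEig (c w) else fun i => (Circle.exp (c w i) : ℂ)) 0)) *
        (((if w ∈ S then boostEig (c w) else fun i => (Circle.exp (c w i) : ℂ)) 1) - ((if w ∈ S then boostEig (c w) else fun i => (Circle.exp (c w i) : ℂ)) 2)) := by
  obtain ⟨htr, hdet⟩ := trace_det_map_evalC_fst_endoTorus L S c w
  rw [← Polynomial.eval₂_at_apply, ← Polynomial.eval_map]
  unfold archCharpolyTwo
  rw [← Matrix.charpoly_map, Matrix.charpoly_fin_two, htr, hdet, evalC_archGammaTwo_endoTorus L S c w, triple_one]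
  simp only [eval_add, eval_sub, eval_mul, eval_pow, eval_X, eval_C]
  ring

/-- **`σ_w(det g) = E_w0 · E_w2`** at `endoTorus S c`. [cite: Rogawski1990, §8.2 p. 122] -/
theorem evalC_det_fst_endoTorus :
    UnitaryGroup.evalC L w
        ((((endoTorus L S c).1 : ↥(UnitaryGroup.arch (↥(maximalRealSubfield L)) L (IsCMField.complexConj L) 2
          (Matrix.of fun i j : Fin 2 => if i.val + j.val + 1 = 2 then (1 : L) else 0))) : GL (Fin 2) (mixedEmbedding.mixedSpace L)) :
            Matrix (Fin 2) (Fin 2) (mixedEmbedding.mixedSpace L)).det =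
      ((if w ∈ S then boostEig (c w) else fun i => (Circle.exp (c w i) : ℂ)) 0) * ((if w ∈ S then boostEig (c w) else fun i => (Circle.exp (c w i) : ℂ)) 2) := by
  rw [RingHom.map_det, RingHom.mapMatrix_apply]
  exact (trace_det_map_evalC_fst_endoTorus L S c w).2

/-- **`σ_w(A) = −q_w · (E_w0 E_w2)⁻¹`** for `τ`'s argument `A = −χ_g(γ₂)·det g⁻¹` at `endoTorus S c`. [cite: Rogawski1990, §4.9 p. 55] -/
theorem evalC_archTauArg_endoTorus :
    UnitaryGroup.evalC L w (archTauArg L (endoTorus L S c)) =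
      -(((((if w ∈ S then boostEig (c w) else fun i => (Circle.exp (c w i) : ℂ)) 1) - ((if w ∈ S then boostEig (c w) else fun i => (Circle.exp (c w i) : ℂ)) 0)) *
          (((if w ∈ S then boostEig (c w) else fun i => (Circle.exp (c w i) : ℂ)) 1) - ((if w ∈ S then boostEig (c w) else fun i => (Circle.exp (c w i) : ℂ)) 2))) *
        (((if w ∈ S then boostEig (c w) else fun i => (Circle.exp (c w i) : ℂ)) 0) * ((if w ∈ S then boostEig (c w) else fun i => (Circle.exp (c w i) : ℂ)) 2))⁻¹) := by
  unfold archTauArg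
  rw [map_mul, map_neg, evalC_eval_archCharpolyTwo_endoTorus L S c w, neg_mul]
  congr 2
  have hdet : (((((endoTorus L S c).1 : ↥(UnitaryGroup.arch (↥(maximalRealSubfield L)) L (IsCMField.complexConj L) 2
          (Matrix.of fun i j : Fin 2 => if i.val + j.val + 1 = 2 then (1 : L) else 0))) : GL (Fin 2) (mixedEmbedding.mixedSpace L))⁻¹ :
            GL (Fin 2) (mixedEmbedding.mixedSpace L)) : Matrix (Fin 2) (Fin 2) (mixedEmbedding.mixedSpace L)).det *
      ((((endoTorus L S c).1 : ↥(UnitaryGroup.arch (↥(maximalRealSubfield L)) L (IsCMField.complexConj L) 2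
          (Matrix.of fun i j : Fin 2 => if i.val + j.val + 1 = 2 then (1 : L) else 0))) : GL (Fin 2) (mixedEmbedding.mixedSpace L)) :
            Matrix (Fin 2) (Fin 2) (mixedEmbedding.mixedSpace L)).det = 1 := by
    rw [← Matrix.det_mul, ← Units.val_mul, inv_mul_cancel, Units.val_one, Matrix.det_one]
  have h1 := congrArg (UnitaryGroup.evalC L w) hdet
  rw [map_mul, map_one, evalC_det_fst_endoTorus L S c w] at h1
  exact eq_inv_of_mul_eq_one_left h1

/-- **`D_{G∕H,∞}(endoTorus S c) = Π_w ‖(E_w1 − E_w0)(E_w1 − E_w2)‖`** — the unsigned Weyl ratio in coordinates, both charts. [cite: Rogawski1990, §4.9 p. 55] -/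
theorem archWeylRatio_endoTorus :
    archWeylRatio L (endoTorus L S c) = ∏ w : {w : InfinitePlace L // IsComplex w},
      ‖(((if w ∈ S then boostEig (c w) else fun i => (Circle.exp (c w i) : ℂ)) 1) - ((if w ∈ S then boostEig (c w) else fun i => (Circle.exp (c w i) : ℂ)) 0)) *
        (((if w ∈ S then boostEig (c w) else fun i => (Circle.exp (c w i) : ℂ)) 1) - ((if w ∈ S then boostEig (c w) else fun i => (Circle.exp (c w i) : ℂ)) 2))‖ := by
  unfold archWeylRatio
  exact Finset.prod_congr rfl fun w _ => by rw [evalC_eval_archCharpolyTwo_endoTorus L S c w]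

/-! ## §2 The Laurent form of `τ·D_{G∕H,∞}` on the general chart -/

omit [NumberField L] [IsCMField L] in
/-- The conjugation symmetry of the 2-block eigenvalue pair, chart by chart: `ā + b̄ = a⁻¹ + b⁻¹` and `ā·b̄ = a⁻¹·b⁻¹` (split: `ā = b⁻¹`; compact: `ā = a⁻¹`), and `a, b ≠ 0`.
[cite: Knapp1986, Ch. V §3] [cite: Rogawski1990, §8.2 p. 119] -/
private theorem triple_conj_symm :
    (if w ∈ S then boostEig (c w) else fun i => (Circle.exp (c w i) : ℂ)) 0 ≠ 0 ∧ (if w ∈ S then boostEig (c w) else fun i => (Circle.exp (c w i) : ℂ)) 2 ≠ 0 ∧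
    conj ((if w ∈ S then boostEig (c w) else fun i => (Circle.exp (c w i) : ℂ)) 0) + conj ((if w ∈ S then boostEig (c w) else fun i => (Circle.exp (c w i) : ℂ)) 2) =
      ((if w ∈ S then boostEig (c w) else fun i => (Circle.exp (c w i) : ℂ)) 0)⁻¹ + ((if w ∈ S then boostEig (c w) else fun i => (Circle.exp (c w i) : ℂ)) 2)⁻¹ ∧
    conj ((if w ∈ S then boostEig (c w) else fun i => (Circle.exp (c w i) : ℂ)) 0) * conj ((if w ∈ S then boostEig (c w) else fun i => (Circle.exp (c w i) : ℂ)) 2) =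
      ((if w ∈ S then boostEig (c w) else fun i => (Circle.exp (c w i) : ℂ)) 0)⁻¹ * ((if w ∈ S then boostEig (c w) else fun i => (Circle.exp (c w i) : ℂ)) 2)⁻¹ := by
  by_cases hw : w ∈ S
  · simp only [if_pos hw, boostEig, Matrix.cons_val_zero, Matrix.cons_val_two, Matrix.tail_cons, Matrix.head_cons]
    have hca : conj (Complex.exp ((c w 0 : ℂ) + (c w 2 : ℂ) * I)) = (Complex.exp (-(c w 0 : ℂ) + (c w 2 : ℂ) * I))⁻¹ := by
      rw [← Complex.exp_conj, ← Complex.exp_neg, map_add, map_mul, Complex.conj_ofReal, Complex.conj_ofReal, Complex.conj_I]; ring_nf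
    have hcb : conj (Complex.exp (-(c w 0 : ℂ) + (c w 2 : ℂ) * I)) = (Complex.exp ((c w 0 : ℂ) + (c w 2 : ℂ) * I))⁻¹ := by
      rw [← Complex.exp_conj, ← Complex.exp_neg, map_add, map_mul, map_neg, Complex.conj_ofReal, Complex.conj_ofReal, Complex.conj_I]; ring_nf
    refine ⟨Complex.exp_ne_zero _, Complex.exp_ne_zero _, ?_, ?_⟩
    · rw [hca, hcb, add_comm]
    · rw [hca, hcb, mul_comm]
  · simp only [if_neg hw]
    have hca : conj (Circle.exp (c w 0) : ℂ) = (Circle.exp (c w 0) : ℂ)⁻¹ := (Complex.inv_eq_conj (Circle.norm_coe _)).symm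
    have hcb : conj (Circle.exp (c w 2) : ℂ) = (Circle.exp (c w 2) : ℂ)⁻¹ := (Complex.inv_eq_conj (Circle.norm_coe _)).symm
    exact ⟨Circle.coe_ne_zero _, Circle.coe_ne_zero _, by rw [hca, hcb], by rw [hca, hcb]⟩

/-- **(I₁-Δ-S), `H`-SIDE: `τ·D_{G∕H,∞}` ALONG THE GENERAL CHART IS THE COMPACT LAURENT POLYNOMIAL IN THE EIGENVALUE TRIPLE.**  With the odd exponents `2k_w + 1` of
★ `exists_odd_archHeckeValue_single_eq_zpow` (μ-guard `μ|_{𝔸_{L⁺}^×} = ω`), for EVERY Cartan class `S` and ALL coordinates `c`: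
`τ(endoTorus S c)·D_{G∕H,∞}(endoTorus S c) = Π_w [−(E_w0 E_w2)^{k_w}·(E_w1 − E_w0)(E_w1 − E_w2)∕E_w1]`, `E_w = boostEig (c w)` (`w ∈ S`) ∕ `(e^{i c w ·})` (`w ∉ S`) — an entire
function of the split coordinates `(x_w, θ_w, φ_w)`, no modulus and no sign left. [cite: Rogawski1990, §8.2 p. 119; §4.9 p. 55] [cite: Shelstad1979, §4] -/
theorem exists_archTau_mul_archWeylRatio_endoTorus_eq
    (hμω : ∀ x : ideleGroup ↥(maximalRealSubfield L), μ (AdeleRing.ideleBaseChange (↥(maximalRealSubfield L)) L x) = quadraticHeckeCharCM L x) :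
    ∃ k : {w : InfinitePlace L // IsComplex w} → ℤ, ∀ (S : Finset {w : InfinitePlace L // IsComplex w}) (c : {w : InfinitePlace L // IsComplex w} → Fin 3 → ℝ),
      archTau L (endoTorus L S c) μ * (archWeylRatio L (endoTorus L S c) : ℂ) =
        ∏ w : {w : InfinitePlace L // IsComplex w},
          -(((((if w ∈ S then boostEig (c w) else fun i => (Circle.exp (c w i) : ℂ)) 0) * ((if w ∈ S then boostEig (c w) else fun i => (Circle.exp (c w i) : ℂ)) 2)) ^ (k w)) *
              ((((if w ∈ S then boostEig (c w) else fun i => (Circle.exp (c w i) : ℂ)) 1) - ((if w ∈ S then boostEig (c w) else fun i => (Circle.exp (c w i) : ℂ)) 0)) *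
                (((if w ∈ S then boostEig (c w) else fun i => (Circle.exp (c w i) : ℂ)) 1) - ((if w ∈ S then boostEig (c w) else fun i => (Circle.exp (c w i) : ℂ)) 2))) /
            ((if w ∈ S then boostEig (c w) else fun i => (Circle.exp (c w i) : ℂ)) 1)) := by
  -- the odd exponents of the place factors
  choose m hmodd hm using fun w : {w : InfinitePlace L // IsComplex w} => exists_odd_archHeckeValue_single_eq_zpow L μ w hμω
  choose k hk using fun w => hmodd w
  refine ⟨k, fun S c => ?_⟩
  haveI : IsEmpty {w : InfinitePlace L // IsReal w} := ⟨fun v => (not_isReal_iff_isComplex.2 (IsTotallyComplex.isComplex v.1)) v.2⟩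
  -- abbreviate the triple
  set E : {w : InfinitePlace L // IsComplex w} → Fin 3 → ℂ := fun w => if w ∈ S then boostEig (c w) else fun i => (Circle.exp (c w i) : ℂ) with hE
  have hE1 : ∀ w, E w 1 = (Circle.exp (c w 1) : ℂ) := fun w => triple_one L S c w
  -- the readings
  have hγ₂ : ∀ w, (archGammaTwo L (endoTorus L S c)).2 w = E w 1 := fun w => by
    rw [← UnitaryGroup.evalC_apply, hE1]; exact evalC_archGammaTwo_endoTorus L S c w
  have hA : ∀ w, (archTauArg L (endoTorus L S c)).2 w = -(((E w 1 - E w 0) * (E w 1 - E w 2)) * (E w 0 * E w 2)⁻¹) := fun w => by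
    rw [← UnitaryGroup.evalC_apply]; exact evalC_archTauArg_endoTorus L S c w
  unfold archTau
  rw [archWeylRatio_endoTorus L S c, archHeckeValue_eq_prod_single L μ (isUnit_archGammaTwo L (endoTorus L S c))]
  simp_rw [hγ₂]
  by_cases hall : ∀ w : {w : InfinitePlace L // IsComplex w}, (E w 1 - E w 0) * (E w 1 - E w 2) ≠ 0
  · -- all `A_w ≠ 0`: `A` is a unit and `μ_∞(A) = Π_w F_w(A_w)`
    have hAu : IsUnit (archTauArg L (endoTorus L S c)) := by
      refine Prod.isUnit_iff.2 ⟨Pi.isUnit_iff.2 fun v => isEmptyElim v, Pi.isUnit_iff.2 fun w => ?_⟩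
      obtain ⟨h0, h2, -, -⟩ := triple_conj_symm L S c w
      rw [hA w, isUnit_iff_ne_zero, neg_ne_zero]
      exact mul_ne_zero (hall w) (inv_ne_zero (mul_ne_zero h0 h2))
    rw [archHeckeValue_eq_prod_single L μ hAu]
    simp_rw [hA]
    rw [← Finset.prod_inv_distrib, ← Finset.prod_mul_distrib, Complex.ofReal_prod, ← Finset.prod_mul_distrib]
    refine Finset.prod_congr rfl fun w _ => ?_
    obtain ⟨h0, h2, hsum, hprod⟩ := triple_conj_symm L S c w
    rw [hm w _ (by rw [hE1]; exact Circle.coe_ne_zero _), hm w _ (by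
      rw [neg_ne_zero]; exact mul_ne_zero (hall w) (inv_ne_zero (mul_ne_zero h0 h2))), hk w]
    exact unitary_key (E w 0) (E w 1) (E w 2) h0 h2 (by rw [hE1]; exact Circle.norm_coe _) hsum hprod (k w)
  · -- some `A_{w₀} = 0`: `A` is not a unit, `μ_∞(A) = 0`, both sides vanish
    push Not at hall
    obtain ⟨w₀, hw₀⟩ := hall
    have hAnu : ¬ IsUnit (archTauArg L (endoTorus L S c)) := by
      intro hu
      have h := (Pi.isUnit_iff.1 (Prod.isUnit_iff.1 hu).2) w₀
      rw [hA w₀, hw₀, zero_mul, neg_zero, isUnit_iff_ne_zero] at h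
      exact h rfl
    rw [archHeckeValue_of_not_isUnit L μ hAnu, inv_zero, mul_zero, zero_mul]
    symm
    exact Finset.prod_eq_zero (Finset.mem_univ w₀) (by rw [hw₀, mul_zero, zero_div, neg_zero])

end EndoTorus

end Literature.NumberTheory.Rogawski1990

end
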